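import Summits.BirchSwinnertonDyer.BirchSwinnertonDyer.Theorems.Rank1ResidualJetRowDualityPrep
import Summits.BirchSwinnertonDyer.BirchSwinnertonDyer.Theorems.Rank1ResidualJetGlobalDualityLocal
import Summits.BirchSwinnertonDyer.BirchSwinnertonDyer.Theorems.Rank1ResidualJetSignedDualityRelaxed
import Summits.BirchSwinnertonDyer.BirchSwinnertonDyer.Theorems.Rank1ResidualJetSignedGlobalDualityPlus
import HarnessLib

/-!
# Crux V2♭θ `KolyvaginCorankLowerBoundAtTwoTheta` (stmt-BirchSwinnertonDyer-27220), line
# `kolyvagin_depth_split`, stub S1 (prime swap at 2), piece P6: the TWO-TERM RECIPROCITY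
# for the auxiliary class and the swapped Kolyvagin class (any level `N`, complex infinite places)

The `λ₀` half of Kolyvagin's prime swap ([1, Prop. 8]; McCallum 1991, proof of Prop. 5.2;
W. Zhang 2014, (8.4)) evaluates the Poitou–Tate reciprocity law `Σ_v ⟨w_v, C_v⟩_v = 0` for
* an AUXILIARY class `w ∈ H¹(K, E[N])` with the transverse condition `𝒯` at the places of `m`,
  the Kummer (Selmer) condition elsewhere, and NO condition at the place `v₀` of the prime `a` being
  swapped out (`w ∈ H¹_{𝓕(m)^{v₀}}`), and
* the (multiple of the) Kolyvagin class `C` of conductor `c = m·a·ℓ'`, transverse at every place of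
  `c` and Kummer elsewhere (`C ∈ H¹_{𝓕(c)}`),
and finds that every local term vanishes except at `v₀` and at the place `v'` of the new prime `ℓ'`:
`⟨w, C⟩_{v₀} + ⟨w, C⟩_{v'} = 0`. This file proves exactly that, in the tree's currency (cell bsd-jet's
`selmerF`, Howard's dual structures, the Weil transport `w_* C ∈ H¹(K, E[N]^D)`), for ANY level `N`
that is a prime power — in particular `N = 2^M` — using that the infinite places of `K` are complex
(so no parity of `N` is needed: the odd-`p` tree version `dualTransported_selmerF_eq` takes `Odd N`
only to kill the archimedean conditions). Ingredients: `SumLocalTermEqZero` of the Poitou–Tate family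
(`GlobalDuality.sum_localTatePairingZMod_selmer_eq_zero`), the self-duality of `𝓕(c)` under the Weil
transport (Kummer places: `GaloisImage.dualTransported_kummerSelmerStructure_inr`; transverse
places: the hypothesis `h𝒯sd`; infinite places: `H¹(ℂ, ·) = 0`), and Howard's Def. 2.1.6 at the
places of `m`. This is piece P6 of the lead's S1-PLAN (crux dir `S1-PLAN.md`); pure plumbing — the
ORDERS of the two terms (P7) and the auxiliary-class supply (P5) are separate pieces.
HONEST FRAMING: helper (`--supports` 27220); nothing here proves S1, V2♭θ or BSD.
-/

set_option autoImplicit false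
-- the Theorems namespace of this sub repeats the summit name by design (D-0017 nested layout)
set_option linter.dupNamespace false

noncomputable section

open scoped Classical Pointwise
open Function NumberField IsDedekindDomain WeierstrassCurve Field
open Literature.NumberTheory.EllipticCurves Literature.NumberTheory.GaloisRepresentations
open Literature.NumberTheory.EllipticCurves.Jetchev2008
open Literature.NumberTheory.GaloisCohomology
open Literature.NumberTheory.GaloisRepresentations.DiscreteGaloisModule (localTatePairingZMod
  tateDual SelmerStructure)
open Summit.BirchSwinnertonDyer.Rank1Residual.JET.SelmerVocabulary
open Summit.BirchSwinnertonDyer.Rank1Residual.JET.GlobalDuality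

namespace Summit.BirchSwinnertonDyer.BirchSwinnertonDyer.Theorems.KolyvaginLowerBoundAtTwo

variable {K : Type} [Field K] [NumberField K] (W : WeierstrassCurve ℚ) [W.IsElliptic]
  [(W.baseChange K).IsElliptic]
  (p k : ℕ) [Fact p.Prime] [NeZero (p ^ k)]
  [Finite (geomTorsion (W.baseChange K) ((p ^ k : ℕ) : ℤ))]
  (e : geomTorsion (W.baseChange K) ((p ^ k : ℕ) : ℤ) → geomTorsion (W.baseChange K) ((p ^ k : ℕ) : ℤ) →
    AlgebraicClosure K)
  (hμ : ∀ S T, e S T ^ (p ^ k) = 1)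
  (hadd₁ : ∀ S₁ S₂ T, e (S₁ + S₂) T = e S₁ T * e S₂ T)
  (hadd₂ : ∀ S T₁ T₂, e S (T₁ + T₂) = e S T₁ * e S T₂)
  (hgal : ∀ (g : absoluteGaloisGroup K) (S T : geomTorsion (W.baseChange K) ((p ^ k : ℕ) : ℤ)),
    g • e S T = e (g • S) (g • T))
  (halt : ∀ T, e T T = 1) (hnondeg : ∀ T, (∀ S, e S T = 1) → T = 0)

omit [W.IsElliptic] in
include halt hnondeg in
/-- **`𝓕(c)` is self-dual under the Weil transport when the infinite places are complex** (any
prime-power level `p^k`, INCLUDING `p = 2`): twin of the tree's `dualTransported_selmerF_eq` with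
`Odd N` replaced by `IsImaginaryQuadratic K` (at a complex place every local condition is `⊤`).
[cite: Jetchev2008, §5 Thm. 5.1] [cite: MilneADT2006, Ch. I, Cor. 3.4] -/
theorem dualTransported_selmerF_eq_of_isImaginaryQuadratic (hK : IsImaginaryQuadratic K) (hk : 1 ≤ k)
    (inv : LocalInvariants K (p ^ k))
    (hinv : ∀ v : HeightOneSpectrum (𝓞 K), Injective (inv (Sum.inr v)))
    (𝒯 : SelmerStructure ((W.baseChange K).torsionGaloisModule ((p ^ k : ℕ) : ℤ))) (c : ℕ)
    (h𝒯sd : ∀ v ∈ placesDividing K c,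
      inv.dualTransported 𝒯 (weilDualIntertwining (W.baseChange K) (p ^ k) e hμ hadd₁ hadd₂ hgal) (Sum.inr v) =
        𝒯 (Sum.inr v))
    (v : Place K) :
    inv.dualTransported (selmerF W ((p ^ k : ℕ) : ℤ) 𝒯 (placesDividing K c))
        (weilDualIntertwining (W.baseChange K) (p ^ k) e hμ hadd₁ hadd₂ hgal) v =
      selmerF W ((p ^ k : ℕ) : ℤ) 𝒯 (placesDividing K c) v := by
  have hpr : p.Prime := Fact.out
  have hN : IsPrimePow (p ^ k) := ⟨p, k, hpr.prime, Nat.pos_of_ne_zero (by omega), rfl⟩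
  rcases v with w | v
  · rw [addSubgroup_galoisCohomology_inl_eq_top_of_isComplex _ (hK.2.isComplex w)
      (selmerF W ((p ^ k : ℕ) : ℤ) 𝒯 (placesDividing K c) (Sum.inl w))]
    exact addSubgroup_galoisCohomology_inl_eq_top_of_isComplex _ (hK.2.isComplex w) _
  · by_cases hv : v ∈ placesDividing K c
    · have h𝓕v : selmerF W ((p ^ k : ℕ) : ℤ) 𝒯 (placesDividing K c) (Sum.inr v) = 𝒯 (Sum.inr v) := by
        rw [selmerF_inr, if_pos hv]
      rw [dualTransported_congr W (p ^ k) e hμ hadd₁ hadd₂ hgal inv h𝓕v, h𝓕v]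
      exact h𝒯sd v hv
    · have h𝓕v : selmerF W ((p ^ k : ℕ) : ℤ) 𝒯 (placesDividing K c) (Sum.inr v) =
          (W.baseChange K).kummerSelmerStructure ((p ^ k : ℕ) : ℤ) (Sum.inr v) := by
        rw [selmerF_inr, if_neg hv]
      rw [dualTransported_congr W (p ^ k) e hμ hadd₁ hadd₂ hgal inv h𝓕v, h𝓕v]
      haveI : CharZero (v.adicCompletion K) :=
        charZero_of_injective_algebraMap (algebraMap K _).injective
      exact Summit.BirchSwinnertonDyer.Rank1Residual.GaloisImage.dualTransported_kummerSelmerStructure_inr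
        (W.baseChange K) (p ^ k) e hμ hadd₁ hadd₂ hgal halt hnondeg hN v
        (localEulerPoincareCharacteristic_holds (v.adicCompletion K)) inv (hinv v)

include halt hnondeg in
/-- **The two-term reciprocity of the prime swap** (Kolyvagin [1, Prop. 8]; McCallum 1991, proof
of Prop. 5.2; W. Zhang 2014, (8.4) "the (possibly) nonzero contribution only comes from
`v ∈ {ℓ_{j+1}, …, ℓ_{ν+j+1}}` … when `v ∈ {ℓ_{j+2}, …, ℓ_{ν+j}}` both lie in the transverse part, hence the
local pairing yields zero"), at ANY prime-power level `p^k` (so also at `2`) over an imaginary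
quadratic `K`: for `w ∈ H¹_{𝓕(m)^{v₀}}(K, E[p^k])` and `C ∈ H¹_{𝓕(c)}(K, E[p^k])`, where the places of
`c` are those of `m` together with `v₀` and `v'` (neither dividing `m`), the local Tate pairings of
`w` with the Weil transport of `C` at `v₀` and at `v'` sum to zero.
[cite: Kolyvagin1991MathAnn, §2 (proof of Thm. 2.2, ref. [1] Prop. 8)]
[cite: McCallumLMS1991, §5 proof of Prop. 5.2, Prop. 2.2] [cite: WZhang2014, §8 (8.4)]
[cite: Howard2004HeegnerKolyvagin, Def. 2.1.6, Thm. 2.1.11] -/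
theorem localTatePairing_add_eq_zero_of_swap (hK : IsImaginaryQuadratic K) (hk : 1 ≤ k)
    (inv : LocalInvariants K (p ^ k))
    (hinv : ∀ v : HeightOneSpectrum (𝓞 K), Injective (inv (Sum.inr v)))
    (hvan : inv.SumLocalTermEqZero)
    (𝒯 : SelmerStructure ((W.baseChange K).torsionGaloisModule ((p ^ k : ℕ) : ℤ))) {c m : ℕ}
    (h𝒯sd : ∀ v ∈ placesDividing K c,
      inv.dualTransported 𝒯 (weilDualIntertwining (W.baseChange K) (p ^ k) e hμ hadd₁ hadd₂ hgal) (Sum.inr v) =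
        𝒯 (Sum.inr v))
    {v₀ v' : HeightOneSpectrum (𝓞 K)} (hne : v₀ ≠ v')
    (hcov : ∀ v ∈ placesDividing K c, v ∈ placesDividing K m ∨ v = v₀ ∨ v = v')
    (hmc : ∀ v ∈ placesDividing K m, v ∈ placesDividing K c)
    (hv₀m : v₀ ∉ placesDividing K m)
    (hv₀c : v₀ ∈ placesDividing K c) (hv'c : v' ∈ placesDividing K c)
    (w C : galoisCohomology ((W.baseChange K).torsionGaloisModule ((p ^ k : ℕ) : ℤ)) 1)
    (hw : w ∈ ((selmerF W ((p ^ k : ℕ) : ℤ) 𝒯 (placesDividing K m)).relaxedAt {v₀}).selmerGroup)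
    (hC : C ∈ (selmerF W ((p ^ k : ℕ) : ℤ) 𝒯 (placesDividing K c)).selmerGroup) :
    localTatePairingZMod ((W.baseChange K).torsionGaloisModule ((p ^ k : ℕ) : ℤ)) (p ^ k) (Sum.inr v₀) (inv (Sum.inr v₀))
        (galoisCohomology.localization ((W.baseChange K).torsionGaloisModule ((p ^ k : ℕ) : ℤ)) (Sum.inr v₀) 1 w)
        (galoisCohomology.localization (((W.baseChange K).torsionGaloisModule ((p ^ k : ℕ) : ℤ)).tateDual (p ^ k)) (Sum.inr v₀) 1
          (galoisCohomology.map (weilDualIntertwining (W.baseChange K) (p ^ k) e hμ hadd₁ hadd₂ hgal) 1 C)) +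
      localTatePairingZMod ((W.baseChange K).torsionGaloisModule ((p ^ k : ℕ) : ℤ)) (p ^ k) (Sum.inr v') (inv (Sum.inr v'))
        (galoisCohomology.localization ((W.baseChange K).torsionGaloisModule ((p ^ k : ℕ) : ℤ)) (Sum.inr v') 1 w)
        (galoisCohomology.localization (((W.baseChange K).torsionGaloisModule ((p ^ k : ℕ) : ℤ)).tateDual (p ^ k)) (Sum.inr v') 1
          (galoisCohomology.map (weilDualIntertwining (W.baseChange K) (p ^ k) e hμ hadd₁ hadd₂ hgal) 1 C)) = 0 := by
  have hpr : p.Prime := Fact.out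
  have hN : IsPrimePow (p ^ k) := ⟨p, k, hpr.prime, Nat.pos_of_ne_zero (by omega), rfl⟩
  set 𝓕 := selmerF W ((p ^ k : ℕ) : ℤ) 𝒯 (placesDividing K c) with h𝓕
  set 𝓖 := (𝓕.relaxedAt {v₀}).relaxedAt {v'} with h𝓖
  set y := galoisCohomology.map (weilDualIntertwining (W.baseChange K) (p ^ k) e hμ hadd₁ hadd₂ hgal) 1 C
    with hy
  have hM : ∀ P : geomTorsion (W.baseChange K) ((p ^ k : ℕ) : ℤ), (p ^ k) • P = 0 := fun P => by
    simpa using (W.baseChange K).natAbs_nsmul_geomTorsion P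
  -- (1) the transport of `C` lies in the dual Selmer group of `𝓕 = 𝓕(c)` (self-duality)
  have hsd : inv.dualTransported 𝓕 (weilDualIntertwining (W.baseChange K) (p ^ k) e hμ hadd₁ hadd₂ hgal) = 𝓕 :=
    funext (dualTransported_selmerF_eq_of_isImaginaryQuadratic W p k e hμ hadd₁ hadd₂ hgal halt hnondeg
      hK hk inv hinv 𝒯 c h𝒯sd)
  have hyd : y ∈ (inv.dualSelmerStructure ((W.baseChange K).torsionGaloisModule ((p ^ k : ℕ) : ℤ)) 𝓕).selmerGroup := by
    have h : C ∈ ((inv.dualSelmerStructure ((W.baseChange K).torsionGaloisModule ((p ^ k : ℕ) : ℤ)) 𝓕).selmerGroup).comap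
        (galoisCohomology.map (weilDualIntertwining (W.baseChange K) (p ^ k) e hμ hadd₁ hadd₂ hgal) 1) := by
      rw [comap_map_weilDual_selmerGroup W (p ^ k) e hμ hadd₁ hadd₂ hgal inv 𝓕, hsd]
      exact hC
    exact h
  -- (2) `w` lies in `𝓖 = 𝓕(c)` relaxed at `v₀` and `v'`
  have h𝓖𝓕 : ∀ v : HeightOneSpectrum (𝓞 K), v ≠ v₀ → v ≠ v' → 𝓖 (Sum.inr v) = 𝓕 (Sum.inr v) := by
    intro v hv₀ hv'
    rw [h𝓖, relaxedAt_inr_of_ne W _ _ hv', relaxedAt_inr_of_ne W _ _ hv₀]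
  have hw𝓖 : w ∈ 𝓖.selmerGroup := by
    rw [SelmerStructure.mem_selmerGroup_iff] at hw ⊢
    intro v
    rcases v with u | v
    · rw [addSubgroup_galoisCohomology_inl_eq_top_of_isComplex _ (hK.2.isComplex u) (𝓖 (Sum.inl u))]
      trivial
    · by_cases hv' : v = v'
      · subst hv'
        rw [h𝓖, relaxedAt_inr_self]
        trivial
      by_cases hv₀ : v = v₀
      · subst hv₀
        rw [h𝓖, relaxedAt_inr_of_ne W _ _ hv', relaxedAt_inr_self]
        trivial
      rw [h𝓖𝓕 v hv₀ hv', h𝓕, selmerF_inr]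
      have h := hw (Sum.inr v)
      rw [relaxedAt_inr_of_ne W _ _ hv₀, selmerF_inr] at h
      have hiff : v ∈ placesDividing K c ↔ v ∈ placesDividing K m := by
        refine ⟨fun h' ↦ ?_, hmc v⟩
        rcases hcov v h' with h'' | h'' | h''
        · exact h''
        · exact absurd h'' hv₀
        · exact absurd h'' hv'
      by_cases hvm : v ∈ placesDividing K m
      · rw [if_pos (hiff.mpr hvm)]; rwa [if_pos hvm] at h
      · rw [if_neg (fun h' ↦ hvm (hiff.mp h'))]; rwa [if_neg hvm] at h
  -- (3) an exceptional set of places containing those of `c`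
  obtain ⟨S, T, hPT, hST, -, -, -, h𝓚⟩ := exists_symmetric_exceptional W (1 : K ≃ₐ[ℚ] K) p k
    (mul_one 1) (placesDividing K c)
  have hcS : ∀ v ∈ placesDividing K c, (Sum.inr v : Place K) ∈ S := fun v hv =>
    (hST v).mpr (hPT hv)
  have h𝓕unr : 𝓕.IsUnramifiedOutside S := selmerF_isUnramifiedOutside W ((p ^ k : ℕ) : ℤ) 𝒯 h𝓚 hcS
  have h𝓖unr : 𝓖.IsUnramifiedOutside S := by
    refine ⟨h𝓕unr.1, fun v hv ↦ ?_⟩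
    have hv₀ : v ≠ v₀ := fun h ↦ hv (h ▸ hcS v₀ hv₀c)
    have hv' : v ≠ v' := fun h ↦ hv (h ▸ hcS v' hv'c)
    rw [h𝓖𝓕 v hv₀ hv']
    exact h𝓕unr.2 v hv
  have hinf : ∀ u : InfinitePlace K, 𝓕 (Sum.inl u) = 𝓖 (Sum.inl u) := fun u ↦ by
    rw [h𝓖, relaxedAt_inl, relaxedAt_inl]
  -- (4) Poitou–Tate: the sum of the local terms over the finite places of `S` vanishes
  have hsum := sum_localTatePairingZMod_selmer_eq_zero (ρ := ((W.baseChange K).torsionGaloisModule ((p ^ k : ℕ) : ℤ))) hvan hM S T hST h𝓕unr h𝓖unr hinf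
    hw𝓖 hyd
  -- (5) every term other than those at `v₀`, `v'` vanishes (Howard Def. 2.1.6 at the places of `m`)
  have hv₀T : v₀ ∈ T := hPT hv₀c
  have hv'T : v' ∈ T := hPT hv'c
  rw [Finset.sum_eq_add_of_mem v₀ v' hv₀T hv'T hne] at hsum
  · exact hsum
  · intro t _ ht
    have hwt : galoisCohomology.localization ((W.baseChange K).torsionGaloisModule ((p ^ k : ℕ) : ℤ)) (Sum.inr t) 1 w ∈ 𝓕 (Sum.inr t) := by
      rw [← h𝓖𝓕 t ht.1 ht.2]
      exact ((𝓖.mem_selmerGroup_iff w).mp hw𝓖) (Sum.inr t)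
    have hyt := ((SelmerStructure.mem_selmerGroup_iff _ y).mp hyd) (Sum.inr t)
    rw [LocalInvariants.dualSelmerStructure_apply, LocalInvariants.mem_dualLocalCondition_iff] at hyt
    exact hyt _ hwt

end Summit.BirchSwinnertonDyer.BirchSwinnertonDyer.Theorems.KolyvaginLowerBoundAtTwo

end
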